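import Literature.Probability.RandomPlanarGeometry.SLETraceEightOfThm44
import HarnessLib

/-!
# [LSW04] Thm. 4.4 (the driving process of the UST Peano curve is close to `B(8t)`) as a named
# fact, and `USTPeano.drivingProcess_tendsto` from it

G. F. Lawler, O. Schramm, W. Werner, *Conformal invariance of planar loop-erased random walks and
uniform spanning trees*, Ann. Probab. **32** (2004) 939–995 (**[LSW04]**). Librarian fact
decomposition (`fact-decompose`, human 2026-08-16) of the budget-capped named fact
`Literature.Probability.RandomPlanarGeometry.USTPeano.drivingProcess_tendsto` (`LSW2004UST.lean`:
the sentence "Theorem 4.4 implies that the law of `W` converges weakly to the law of `B(8t)`" of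
the proof of Thms. 4.7/4.8, p. 981).

State of the tree: that sentence is PROVED from Thm. 4.4 as printed alone —
`USTPeano.drivingProcess_tendsto_of_thm44'` (`LSW2004USTRado.lean`; steps (i) `rad₀(D^{Rₙ}) → ∞`,
(ii) the harmonic measure of the wired arc stays in `(0,1)` via `R⁻¹φ_R⁻¹ → φ⁻¹` — Radó's theorem,
`tendstoUniformlyOn_inv_mul` — and (iii) couplings ⇒ weak convergence,
`tendstoInDistribution_of_thm44_shape`), with Thm. 4.4 displayed as the hypothesis `h44`. This file
names that hypothesis:

* `USTPeano.thm44_coupling` — **[LSW04] Thm. 4.4** (p. 976) in its printed coupling shape,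
  verbatim the hypothesis `h44` of `drivingProcess_tendsto_of_thm44` / `…_of_thm44'` (see the
  docstring of the former for the rendering of `rad₀(D) > r₁` and `ℌ_D(0, α) ∈ [ε₁, 1 − ε₁]`);
* `USTPeano.drivingProcess_tendsto_holds_of : thm44_coupling → drivingProcess_tendsto` — the
  assembly (`drivingProcess_tendsto_of_thm44'`);
* `USTPeano.hasSLETrace_eight_of_prop45_of_thm44_coupling` — Thm. 4.7 from Prop. 4.5 and the
  child (`hasSLETrace_eight_of_prop45_of_thm44`).

The child does not restate the parent: Thm. 4.4 is a statement about ONE lattice domain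
`D ∈ 𝔇*` (inner radius, harmonic measure, a coupling with `sup_{[0,t̄]}|W − B(8·)|` small), the
parent is weak convergence along grid approximations of a smooth domain. What remains of the
child is the UST/LERW theory of [LSW04] §4.1–4.2 (Wilson's algorithm, Prop. 4.1, the key estimate
Prop. 4.2) — the Skorokhod-embedding engine of §3.3 being PROVED
(`DrivingConvergenceEngine.lean`: `exists_delta_forall_coupling_lt`,
`drivingProcess_tendsto_of_rawDrivingData`).

## References

* [LSW04] Thm. 4.4 (p. 976), Prop. 4.5 (p. 977), proof of Thms. 4.7/4.8 (p. 981); §3.3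
  [LawlerSchrammWerner2004].
-/

noncomputable section

open MeasureTheory Metric Complex
open UpperHalfPlane (upperHalfPlaneSet)
open scoped NNReal

namespace Literature.Probability.RandomPlanarGeometry

open scoped PathBorel

namespace USTPeano

/-- **[LSW04] Theorem 4.4** (p. 976): "For every positive `ε₁, ε₂, ε₃` and `t̄`, there is some
positive `r₁ = r₁(ε₁, ε₂, ε₃, t̄)` such that the following holds. Let `D = D(α, β, a, b) ∈ 𝔇*`
satisfy `rad₀(D) > r₁` and `ℌ_D(0, α) ∈ [ε₁, 1 − ε₁]`. Let `γ` be [the] corresponding UST Peano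
path, let `φ : D → ℍ` denote the conformal map which takes `a` to `0`, `b` to `∞` and satisfies
`|φ(0)| = 1`, let `γ̂ := φ ∘ γ`, parameterized according to capacity from `∞`, and let `W(t)`
denote the Loewner driving process for `γ̂`. Then there is a coupling of standard Brownian motion
`B` and `W` such that `P[sup{|W(t) − B(8t)| : t ∈ [0, t̄]} > ε₂] < ε₃`." Rendering (that of
`drivingProcess_tendsto_of_thm44`, whose hypothesis `h44` this is, verbatim): the simple-path
class `USTPeano.Domain` with `0 ∈ D`; `rad₀(D) > r₁` as `B(0, r₁) ⊆ D`; the harmonic-measure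
condition through the normalised map (`ℍ → D`, `Δ.IsLSWMap φ`) as `arg φ(0) ∈ [ε₁π, (1 − ε₁)π]`;
universal over normalised maps and capacity images (`IsCapacityImage`, both unique); the coupling
a measure on pairs of paths with first marginal the law of `W` under `ustLaw Δ` and second
marginal the law of `B(8·)` of the canonical Brownian motion (`brownianTimeEight`), giving the
event `{∃ t ≤ T, ε₂ < |W(t) − B(8t)|}` mass `< ε₃`. Depends on Props. 4.1–4.2 and §3.3
(Skorokhod embedding — proved in the tree, `DrivingConvergenceEngine.lean`).
[cite: LawlerSchrammWerner2004, Thm. 4.4 (p. 976)] -/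
def thm44_coupling : Prop :=
  ∀ (ε₁ ε₂ ε₃ T : ℝ), 0 < ε₁ → 0 < ε₂ → 0 < ε₃ → 0 < T → ∃ r₁ : ℝ, ∀ (Δ : Domain),
    (0 : ℂ) ∈ Δ.carrier → ball (0 : ℂ) r₁ ⊆ Δ.carrier →
    ∀ (φ : ConformalEquiv upperHalfPlaneSet Δ.carrier), Δ.IsLSWMap φ →
      ε₁ * Real.pi ≤ arg (φ.symm 0) → arg (φ.symm 0) ≤ (1 - ε₁) * Real.pi →
      ∀ (Γ : PeanoPath Δ → C(ℝ≥0, ℂ)) (W : PeanoPath Δ → C(ℝ≥0, ℝ)),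
        (∀ γ, IsCapacityImage Δ φ γ (Γ γ) (W γ)) →
        ∃ ρ : Measure (C(ℝ≥0, ℝ) × C(ℝ≥0, ℝ)), ρ.fst = (ustLaw Δ).map W ∧
          ρ.snd = Process.preWienerMeasure.map brownianTimeEight ∧
          ρ {p | ∃ t : ℝ≥0, (t : ℝ) ≤ T ∧ ε₂ < dist (p.1 t) (p.2 t)} < ENNReal.ofReal ε₃

/-- **`USTPeano.drivingProcess_tendsto` from [LSW04] Thm. 4.4** (the fact split; [LSW04] p. 981:
"Theorem 4.4 implies that the law of `W` converges weakly to the law of `B(8t)`") — the tree's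
`drivingProcess_tendsto_of_thm44'`. [cite: LawlerSchrammWerner2004, Thm. 4.4 and proof of Thm. 4.7 (p. 981)] -/
theorem drivingProcess_tendsto_holds_of (h44 : thm44_coupling) : drivingProcess_tendsto :=
  drivingProcess_tendsto_of_thm44' h44

/-- **[LSW04] Thm. 4.7 (SLE₈ is generated by a curve, `hasSLETrace_eight`) from Prop. 4.5 (as the
displayed hypothesis `h45`) and the child `thm44_coupling`** — `hasSLETrace_eight_of_prop45_of_thm44`.
[cite: LawlerSchrammWerner2004, Thm. 4.7 (proof, p. 981)] -/
theorem hasSLETrace_eight_of_prop45_of_thm44_coupling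
    (h45 : ∀ (D : SmoothDomain) (ε t : ℝ), 0 < ε → 0 < t →
      ∃ R₀ δ : ℝ, 0 < δ ∧ ∀ (R : ℝ) (Δ : Domain), R₀ < R → IsApproximation D R Δ →
        ∀ (φ : ConformalEquiv upperHalfPlaneSet Δ.carrier), Δ.IsLSWMap φ →
          ∀ (Γ : PeanoPath Δ → C(ℝ≥0, ℂ)) (W : PeanoPath Δ → C(ℝ≥0, ℝ)),
            (∀ γ, IsCapacityImage Δ φ γ (Γ γ) (W γ)) →
              ustLaw Δ {γ | ∃ t₁ t₂ : ℝ≥0, (t₁ : ℝ) ≤ t ∧ (t₂ : ℝ) ≤ t ∧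
                dist t₁ t₂ ≤ δ ∧ ε < dist (Γ γ t₁) (Γ γ t₂)} < ENNReal.ofReal ε)
    (h44 : thm44_coupling) : hasSLETrace_eight :=
  hasSLETrace_eight_of_prop45_of_thm44 h45 h44

end USTPeano

end Literature.Probability.RandomPlanarGeometry

end
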